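import Literature.NumberTheory.Rogawski1990.ArchWeilDataCongruence          -- ★ (T-d): Weil data pushed along a congruence ((W), (C′), (C′G))
import Literature.NumberTheory.Rogawski1990.ArchInnerTransferCongruence     -- ★ (T-d): `isArchInnerTransfer_transport_left_iff`
import Literature.NumberTheory.Rogawski1990.ArchSmoothCongruence            -- ★ (T-d): `ArchSmooth.comp_archCongr`
import Literature.NumberTheory.Rogawski1990.ArchCompatibleFamilies           -- ★ `ArchCompatibleFamiliesG`
import Literature.NumberTheory.Rogawski1990.ArchimedeanTransfer              -- ★ `IsArchInnerTransferExists`, `ArchSmooth`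
import HarnessLib

/-!
# The one-system sentence of the archimedean inner-form transfer is carried by a congruence of the inner form (N8-INNER, adapter (S0))

Topic `NumberTheory/Rogawski1990`; namespace `Literature.NumberTheory.Rogawski1990`.  THEOREMS ONLY (no `def`, no instance, no notation,
no axiom, no named fact, no `sorry`).

Print's one-system sentence at `(H′, Φ₃, ν′, ν)` — «there is a compatible Weil-form system `(m′, m, t′, t)` (★ `ArchCompatibleFamiliesG`,
[Rogawski1990, §1.7 p. 6], [Shelstad1979, §4 p. 20]) for which every `a′ ∈ C_c^∞(U(H′)_∞)` has a (14.2.1)-transfer `f ∈ C_c^∞(U(Φ₃)_∞)`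
(★ `IsArchInnerTransferExists`)» — is TRANSPORTED along an ambient congruence of the inner form `Θ : U(H₂)_∞ ≃ₜ* U(H)_∞`,
`Θ g = T g T⁻¹`, from the frame `(H₂, ν₂)` to the frame `(H, ν′)` with `ν′ = ν₂.map Θ`: push the `G′`-side family and torus datum
along `Θ` ((W′) ★ `isQuotientOf_transport_archCongr`, (C′) ★ `map_archStableCentralizerEquiv_torusPush_eq`, (C′G) ★
`map_archStableCentralizerEquiv_torusPush_eq_of_cross`), keep the `G`-side data, and move the transfer relation by ★
`isArchInnerTransfer_transport_left_iff` with `a′ ↦ a′ ∘ Θ` (★ `ArchSmooth.comp_archCongr`).  This is the adapter reducing the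
sentence at a general anisotropic hermitian `H` to the diagonal frames `H₂ = diagonal α` (where ★ `ArchInnerTransferJunction` pays it).

* `exists_archCompatibleFamiliesG_and_isArchInnerTransferExists_transport` — the adapter.

HONEST LABEL.  Pure transport; asserts nothing new.  HC_CM is proved only modulo the printed citations until rung 0 closes.

## References
* [Rogawski1990] J. D. Rogawski, *Automorphic Representations of Unitary Groups in Three Variables*, Ann. of Math. Stud. 123 (1990), §1.7 p. 6,
  §4.3 (4.3.1) pp. 43–44, §14.2 (14.2.1) pp. 232–233, §14.4 p. 237.
* [Shelstad1979] D. Shelstad, *Characters and inner forms of a quasi-split group over ℝ*, Compositio Math. 39 (1979) 11–45, §4 p. 20.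
-/

set_option autoImplicit false

noncomputable section

open MeasureTheory MeasureTheory.Measure NumberField NumberField.InfinitePlace Matrix Complex Topology
open Literature.MeasureTheory.Group
open scoped MatrixGroups Matrix Classical NNReal ENNReal

namespace Literature.NumberTheory.Rogawski1990

open Literature.NumberTheory.Automorphic Literature.NumberTheory.Automorphic.UnitaryGroup

section Transport

variable (L : Type) [Field L] [NumberField L] [IsCMField L] {H H₂ : Matrix (Fin 3) (Fin 3) L}
  [MeasurableSpace ↥(arch (↥(maximalRealSubfield L)) L (IsCMField.complexConj L) 3 H)]
  [BorelSpace ↥(arch (↥(maximalRealSubfield L)) L (IsCMField.complexConj L) 3 H)]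
  [MeasurableSpace ↥(arch (↥(maximalRealSubfield L)) L (IsCMField.complexConj L) 3 H₂)]
  [BorelSpace ↥(arch (↥(maximalRealSubfield L)) L (IsCMField.complexConj L) 3 H₂)]
  [MeasurableSpace ↥(arch (↥(maximalRealSubfield L)) L (IsCMField.complexConj L) 3
      (Matrix.of fun i j : Fin 3 => if i.val + j.val + 1 = 3 then (1 : L) else 0))]
  [BorelSpace ↥(arch (↥(maximalRealSubfield L)) L (IsCMField.complexConj L) 3
      (Matrix.of fun i j : Fin 3 => if i.val + j.val + 1 = 3 then (1 : L) else 0))]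
  (ν₂ : Measure ↥(arch (↥(maximalRealSubfield L)) L (IsCMField.complexConj L) 3 H₂))
  (ν' : Measure ↥(arch (↥(maximalRealSubfield L)) L (IsCMField.complexConj L) 3 H))
  (ν : Measure ↥(arch (↥(maximalRealSubfield L)) L (IsCMField.complexConj L) 3
      (Matrix.of fun i j : Fin 3 => if i.val + j.val + 1 = 3 then (1 : L) else 0)))
  [ν₂.IsHaarMeasure] [ν₂.IsMulRightInvariant] [ν'.IsHaarMeasure] [ν'.IsMulRightInvariant] [ν.IsHaarMeasure] [ν.IsMulRightInvariant]
  (T : GL (Fin 3) (mixedEmbedding.mixedSpace L))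
  (Θ : ↥(arch (↥(maximalRealSubfield L)) L (IsCMField.complexConj L) 3 H₂) ≃ₜ* ↥(arch (↥(maximalRealSubfield L)) L (IsCMField.complexConj L) 3 H))
  (hΘ : ∀ g : ↥(arch (↥(maximalRealSubfield L)) L (IsCMField.complexConj L) 3 H₂),
    ((Θ g : ↥(arch (↥(maximalRealSubfield L)) L (IsCMField.complexConj L) 3 H)) : GL (Fin 3) (mixedEmbedding.mixedSpace L)) =
      T * (g : GL (Fin 3) (mixedEmbedding.mixedSpace L)) * T⁻¹)

include hΘ in
/-- **THE ONE-SYSTEM SENTENCE IS CARRIED BY A CONGRUENCE OF THE INNER FORM.**  For an ambient congruence `Θ : U(H₂)_∞ ≃ₜ* U(H)_∞`,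
`Θ g = T g T⁻¹`, Haar measures with `ν′ = ν₂.map Θ`, and anisotropic `H₂`, `H`: a compatible Weil-form system at `(H₂, Φ₃, ν₂, ν)` with the
`C_c^∞` inner transfer (14.2.1) gives one at `(H, Φ₃, ν′, ν)` — the `G′`-side family is pushed along `Θ` (★ `OrbitalMeasureFamily.transport`), its torus
datum is the pushed datum (★ `exists_torusPush_archCongr`): (W′) ★ `isQuotientOf_transport_archCongr`, (C′) ★ `map_archStableCentralizerEquiv_torusPush_eq`,
(C′G) ★ `map_archStableCentralizerEquiv_torusPush_eq_of_cross`; the `G`-side data are kept; for `a′ ∈ C_c^∞(U(H)_∞)` the transfer of `a′ ∘ Θ`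
(★ `ArchSmooth.comp_archCongr`) is a transfer of `a′` by ★ `isArchInnerTransfer_transport_left_iff`.  Shelstad: «the pair `dt′, ψ_x` defines a
measure `dt` on `T`, independently of the choice of `x`». [cite: Rogawski1990, §14.2 (14.2.1) pp. 232–233; §1.7 p. 6; §4.3 (4.3.1) pp. 43–44] [cite: Shelstad1979, §4 p. 20] -/
theorem exists_archCompatibleFamiliesG_and_isArchInnerTransferExists_transport (hν : ν' = Measure.map Θ ν₂)
    (hanis₂ : ∀ x : Fin 3 → L, Literature.AlgebraicGeometry.ShimuraVarieties.hermForm (cmConjRingHom L) H₂ x x = 0 → x = 0)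
    (hanis : ∀ x : Fin 3 → L, Literature.AlgebraicGeometry.ShimuraVarieties.hermForm (cmConjRingHom L) H x x = 0 → x = 0)
    (h : letI : ∀ γ : ↥(arch (↥(maximalRealSubfield L)) L (IsCMField.complexConj L) 3 H₂),
          MeasurableSpace (↥(arch (↥(maximalRealSubfield L)) L (IsCMField.complexConj L) 3 H₂) ⧸
            Subgroup.centralizer ({γ} : Set ↥(arch (↥(maximalRealSubfield L)) L (IsCMField.complexConj L) 3 H₂))) :=
        fun _ => borel _
      haveI : ∀ γ : ↥(arch (↥(maximalRealSubfield L)) L (IsCMField.complexConj L) 3 H₂),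
          BorelSpace (↥(arch (↥(maximalRealSubfield L)) L (IsCMField.complexConj L) 3 H₂) ⧸
            Subgroup.centralizer ({γ} : Set ↥(arch (↥(maximalRealSubfield L)) L (IsCMField.complexConj L) 3 H₂))) :=
        fun _ => ⟨rfl⟩
      letI : ∀ γ : ↥(arch (↥(maximalRealSubfield L)) L (IsCMField.complexConj L) 3
            (Matrix.of fun i j : Fin 3 => if i.val + j.val + 1 = 3 then (1 : L) else 0)),
          MeasurableSpace (↥(arch (↥(maximalRealSubfield L)) L (IsCMField.complexConj L) 3
              (Matrix.of fun i j : Fin 3 => if i.val + j.val + 1 = 3 then (1 : L) else 0)) ⧸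
            Subgroup.centralizer ({γ} : Set ↥(arch (↥(maximalRealSubfield L)) L (IsCMField.complexConj L) 3
              (Matrix.of fun i j : Fin 3 => if i.val + j.val + 1 = 3 then (1 : L) else 0)))) :=
        fun _ => borel _
      haveI : ∀ γ : ↥(arch (↥(maximalRealSubfield L)) L (IsCMField.complexConj L) 3
            (Matrix.of fun i j : Fin 3 => if i.val + j.val + 1 = 3 then (1 : L) else 0)),
          BorelSpace (↥(arch (↥(maximalRealSubfield L)) L (IsCMField.complexConj L) 3
              (Matrix.of fun i j : Fin 3 => if i.val + j.val + 1 = 3 then (1 : L) else 0)) ⧸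
            Subgroup.centralizer ({γ} : Set ↥(arch (↥(maximalRealSubfield L)) L (IsCMField.complexConj L) 3
              (Matrix.of fun i j : Fin 3 => if i.val + j.val + 1 = 3 then (1 : L) else 0)))) :=
        fun _ => ⟨rfl⟩
      ∃ (m₂ : OrbitalMeasureFamily ↥(arch (↥(maximalRealSubfield L)) L (IsCMField.complexConj L) 3 H₂))
        (m : OrbitalMeasureFamily ↥(arch (↥(maximalRealSubfield L)) L (IsCMField.complexConj L) 3
          (Matrix.of fun i j : Fin 3 => if i.val + j.val + 1 = 3 then (1 : L) else 0)))
        (t₂ : ∀ γ₂ : ↥(arch (↥(maximalRealSubfield L)) L (IsCMField.complexConj L) 3 H₂),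
          Measure (Subgroup.centralizer ({γ₂} : Set ↥(arch (↥(maximalRealSubfield L)) L (IsCMField.complexConj L) 3 H₂))))
        (t : ∀ γ : ↥(arch (↥(maximalRealSubfield L)) L (IsCMField.complexConj L) 3
            (Matrix.of fun i j : Fin 3 => if i.val + j.val + 1 = 3 then (1 : L) else 0)),
          Measure (Subgroup.centralizer ({γ} : Set ↥(arch (↥(maximalRealSubfield L)) L (IsCMField.complexConj L) 3
            (Matrix.of fun i j : Fin 3 => if i.val + j.val + 1 = 3 then (1 : L) else 0))))),
        ArchCompatibleFamiliesG L H₂ ν₂ ν hanis₂ m₂ m t₂ t ∧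
          IsArchInnerTransferExists L H₂ m₂ m (ArchSmooth L 3 H₂)
            (ArchSmooth L 3 (Matrix.of fun i j : Fin 3 => if i.val + j.val + 1 = 3 then (1 : L) else 0))) :
    letI : ∀ γ : ↥(arch (↥(maximalRealSubfield L)) L (IsCMField.complexConj L) 3 H),
        MeasurableSpace (↥(arch (↥(maximalRealSubfield L)) L (IsCMField.complexConj L) 3 H) ⧸
          Subgroup.centralizer ({γ} : Set ↥(arch (↥(maximalRealSubfield L)) L (IsCMField.complexConj L) 3 H))) :=
      fun _ => borel _
    haveI : ∀ γ : ↥(arch (↥(maximalRealSubfield L)) L (IsCMField.complexConj L) 3 H),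
        BorelSpace (↥(arch (↥(maximalRealSubfield L)) L (IsCMField.complexConj L) 3 H) ⧸
          Subgroup.centralizer ({γ} : Set ↥(arch (↥(maximalRealSubfield L)) L (IsCMField.complexConj L) 3 H))) :=
      fun _ => ⟨rfl⟩
    letI : ∀ γ : ↥(arch (↥(maximalRealSubfield L)) L (IsCMField.complexConj L) 3
          (Matrix.of fun i j : Fin 3 => if i.val + j.val + 1 = 3 then (1 : L) else 0)),
        MeasurableSpace (↥(arch (↥(maximalRealSubfield L)) L (IsCMField.complexConj L) 3
            (Matrix.of fun i j : Fin 3 => if i.val + j.val + 1 = 3 then (1 : L) else 0)) ⧸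
          Subgroup.centralizer ({γ} : Set ↥(arch (↥(maximalRealSubfield L)) L (IsCMField.complexConj L) 3
            (Matrix.of fun i j : Fin 3 => if i.val + j.val + 1 = 3 then (1 : L) else 0)))) :=
      fun _ => borel _
    haveI : ∀ γ : ↥(arch (↥(maximalRealSubfield L)) L (IsCMField.complexConj L) 3
          (Matrix.of fun i j : Fin 3 => if i.val + j.val + 1 = 3 then (1 : L) else 0)),
        BorelSpace (↥(arch (↥(maximalRealSubfield L)) L (IsCMField.complexConj L) 3
            (Matrix.of fun i j : Fin 3 => if i.val + j.val + 1 = 3 then (1 : L) else 0)) ⧸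
          Subgroup.centralizer ({γ} : Set ↥(arch (↥(maximalRealSubfield L)) L (IsCMField.complexConj L) 3
            (Matrix.of fun i j : Fin 3 => if i.val + j.val + 1 = 3 then (1 : L) else 0)))) :=
      fun _ => ⟨rfl⟩
    ∃ (m' : OrbitalMeasureFamily ↥(arch (↥(maximalRealSubfield L)) L (IsCMField.complexConj L) 3 H))
      (m : OrbitalMeasureFamily ↥(arch (↥(maximalRealSubfield L)) L (IsCMField.complexConj L) 3
        (Matrix.of fun i j : Fin 3 => if i.val + j.val + 1 = 3 then (1 : L) else 0)))
      (t' : ∀ γ' : ↥(arch (↥(maximalRealSubfield L)) L (IsCMField.complexConj L) 3 H),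
        Measure (Subgroup.centralizer ({γ'} : Set ↥(arch (↥(maximalRealSubfield L)) L (IsCMField.complexConj L) 3 H))))
      (t : ∀ γ : ↥(arch (↥(maximalRealSubfield L)) L (IsCMField.complexConj L) 3
          (Matrix.of fun i j : Fin 3 => if i.val + j.val + 1 = 3 then (1 : L) else 0)),
        Measure (Subgroup.centralizer ({γ} : Set ↥(arch (↥(maximalRealSubfield L)) L (IsCMField.complexConj L) 3
          (Matrix.of fun i j : Fin 3 => if i.val + j.val + 1 = 3 then (1 : L) else 0))))),
      ArchCompatibleFamiliesG L H ν' ν hanis m' m t' t ∧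
        IsArchInnerTransferExists L H m' m (ArchSmooth L 3 H)
          (ArchSmooth L 3 (Matrix.of fun i j : Fin 3 => if i.val + j.val + 1 = 3 then (1 : L) else 0)) := by
  -- the Borel σ-algebras on the three families of orbit quotients (print's convention)
  letI q₂ : ∀ γ : ↥(arch (↥(maximalRealSubfield L)) L (IsCMField.complexConj L) 3 H₂),
      MeasurableSpace (↥(arch (↥(maximalRealSubfield L)) L (IsCMField.complexConj L) 3 H₂) ⧸
        Subgroup.centralizer ({γ} : Set ↥(arch (↥(maximalRealSubfield L)) L (IsCMField.complexConj L) 3 H₂))) :=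
    fun _ => borel _
  haveI : ∀ γ : ↥(arch (↥(maximalRealSubfield L)) L (IsCMField.complexConj L) 3 H₂),
      BorelSpace (↥(arch (↥(maximalRealSubfield L)) L (IsCMField.complexConj L) 3 H₂) ⧸
        Subgroup.centralizer ({γ} : Set ↥(arch (↥(maximalRealSubfield L)) L (IsCMField.complexConj L) 3 H₂))) :=
    fun _ => ⟨rfl⟩
  letI q : ∀ γ : ↥(arch (↥(maximalRealSubfield L)) L (IsCMField.complexConj L) 3 H),
      MeasurableSpace (↥(arch (↥(maximalRealSubfield L)) L (IsCMField.complexConj L) 3 H) ⧸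
        Subgroup.centralizer ({γ} : Set ↥(arch (↥(maximalRealSubfield L)) L (IsCMField.complexConj L) 3 H))) :=
    fun _ => borel _
  haveI : ∀ γ : ↥(arch (↥(maximalRealSubfield L)) L (IsCMField.complexConj L) 3 H),
      BorelSpace (↥(arch (↥(maximalRealSubfield L)) L (IsCMField.complexConj L) 3 H) ⧸
        Subgroup.centralizer ({γ} : Set ↥(arch (↥(maximalRealSubfield L)) L (IsCMField.complexConj L) 3 H))) :=
    fun _ => ⟨rfl⟩
  letI q₃ : ∀ γ : ↥(arch (↥(maximalRealSubfield L)) L (IsCMField.complexConj L) 3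
      (Matrix.of fun i j : Fin 3 => if i.val + j.val + 1 = 3 then (1 : L) else 0)),
      MeasurableSpace (↥(arch (↥(maximalRealSubfield L)) L (IsCMField.complexConj L) 3
          (Matrix.of fun i j : Fin 3 => if i.val + j.val + 1 = 3 then (1 : L) else 0)) ⧸
        Subgroup.centralizer ({γ} : Set ↥(arch (↥(maximalRealSubfield L)) L (IsCMField.complexConj L) 3
          (Matrix.of fun i j : Fin 3 => if i.val + j.val + 1 = 3 then (1 : L) else 0)))) :=
    fun _ => borel _
  haveI : ∀ γ : ↥(arch (↥(maximalRealSubfield L)) L (IsCMField.complexConj L) 3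
      (Matrix.of fun i j : Fin 3 => if i.val + j.val + 1 = 3 then (1 : L) else 0)),
      BorelSpace (↥(arch (↥(maximalRealSubfield L)) L (IsCMField.complexConj L) 3
          (Matrix.of fun i j : Fin 3 => if i.val + j.val + 1 = 3 then (1 : L) else 0)) ⧸
        Subgroup.centralizer ({γ} : Set ↥(arch (↥(maximalRealSubfield L)) L (IsCMField.complexConj L) 3
          (Matrix.of fun i j : Fin 3 => if i.val + j.val + 1 = 3 then (1 : L) else 0)))) :=
    fun _ => ⟨rfl⟩
  obtain ⟨m₂, m, t₂, t, ⟨hW₂, hW, hC₂, hC, hCG₂⟩, hT⟩ := h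
  -- frame constants
  have hd₂ : H₂.det ≠ 0 := Godement.det_ne_zero_of_anisotropic L H₂ hanis₂
  have hd : H.det ≠ 0 := Godement.det_ne_zero_of_anisotropic L H hanis
  have hd₃ : (Matrix.of fun i j : Fin 3 => if i.val + j.val + 1 = 3 then (1 : L) else 0).det ≠ 0 :=
    (isUnit_antidiagOne_det L 3).ne_zero
  -- the `G′`-side torus datum pushed along `Θ`
  obtain ⟨t', ht'⟩ := exists_torusPush_archCongr (L := L) (Φ := Θ) (t₂ := t₂)
  refine ⟨m₂.transport Θ.toMulEquiv Θ.continuous Θ.symm.continuous, m, t', t, ⟨?_, hW, ?_, hC, ?_⟩, ?_⟩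
  · -- (W′) is carried
    exact isQuotientOf_transport_archCongr (L := L) (hH₂ := hd₂) (T := T) (Φ := Θ) (hΦ := hΘ)
      (t₂ := t₂) (t := t') (ht := ht') (hW := hW₂) (hC₂ := hC₂) (ν := ν') hν
  · -- (C′) is carried
    exact fun δ₁ δ₂ h₁ hc => map_archStableCentralizerEquiv_torusPush_eq (L := L) (hH := hd) (hH₂ := hd₂) (T := T) (Φ := Θ) (hΦ := hΘ)
      (t₂ := t₂) (t := t') (ht := ht') hC₂ δ₁ δ₂ h₁ hc
  · -- (C′G) is carried
    exact fun δ a h' hc => map_archStableCentralizerEquiv_torusPush_eq_of_cross (L := L) (hH := hd) (hH₂ := hd₂) (hX := hd₃) (T := T)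
      (Φ := Θ) (hΦ := hΘ) (t₂ := t₂) (t := t') (ht := ht') t hCG₂ δ a h' hc
  · -- the transfer relation is carried
    intro a' ha'
    obtain ⟨f, hf, hIT⟩ := hT (a' ∘ Θ) (ha'.comp_archCongr L T Θ hΘ)
    refine ⟨f, hf, ?_⟩
    have hcomp : (a' ∘ Θ) ∘ Θ.symm = a' := funext fun x => by simp
    have h2 := (isArchInnerTransfer_transport_left_iff L T Θ hΘ m₂ m (a' ∘ Θ) f).2 hIT
    rwa [hcomp] at h2

end Transport

end Literature.NumberTheory.Rogawski1990

end
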